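import Mathlib
import Summits.Ventures.PercRepro2.Defs
import Summits.Ventures.PercRepro2.Independence
import Summits.Ventures.PercRepro2.Harris
import Summits.Ventures.PercRepro2.Graph
import Summits.Ventures.PercRepro2.Events
import Summits.Ventures.PercRepro2.ZCZeroWeight
import Summits.Ventures.PercRepro2.ZCReroute
import Summits.Ventures.PercRepro2.ZCA3WGraph
import Summits.Ventures.PercRepro2.ZCOWGraph
import Summits.Ventures.PercRepro2.ZCRootWGraph
import Summits.Ventures.PercRepro2.ZCRootOWGraph

/-!
# Theorems E, F, G, H for `p`-degree-two marks — the composable forms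
(blind cell PercRepro2, mine-a g24; MINE-A.md §72.8)

The graph instances `zc_a3w_graph`, `zc_rootw_graph`, `zc_ow_graph`, `zc_rootow_graph` assume that the
degree-two mark `v` has EXACTLY the edges `f₁`, `f₂` in `ends`.  Here the hypothesis is weakened to
«every other edge at `v` has weight `0`» (`∀ e, v ∈ ends e → e = f₁ ∨ e = f₂ ∨ p e = 0`), by re-routing
the zero-weight edges at `v` into a loop at another mark (`ZCReroute`).  Since each reduction's
hypothesis is (ZC) under `p[f₁, f₂ ↦ 0]` — a weight vector with MORE zeros — the reductions now
compose in the kernel: strip one degree-two mark after another, ending in a forest or a two-edge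
class.  One seat.
-/

namespace Summit.Ventures.PercRepro2

section InsertP

variable {V : Type*} {E : Type*} [Fintype E] [DecidableEq E] {R : Type*} [CommRing R]
  [LinearOrder R] [IsStrictOrderedRing R]

omit [Fintype E] in
/-- The re-routed endpoint map agrees with `ends` off `Z`. -/
lemma reroute_agree (ends : E → Sym2 V) (Z : Finset E) (x : V) :
    ∀ e, e ∉ Z → ends e = (fun e => if e ∈ Z then s(x, x) else ends e) e := by
  intro e he; simp [he]

omit [Fintype E] [LinearOrder R] [IsStrictOrderedRing R] in
/-- The weights `p[f₁, f₂ ↦ 0]` vanish wherever `p` does. -/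
lemma update_two_zero_of_zero (p : E → R) (f₁ f₂ e : E) (h : p e = 0) :
    Function.update (Function.update p f₁ 0) f₂ 0 e = 0 := by
  by_cases h2 : e = f₂
  · subst h2; simp
  · by_cases h1 : e = f₁
    · subst h1; simp [Function.update_of_ne h2]
    · rw [Function.update_of_ne h2, Function.update_of_ne h1]; exact h

/-- **Theorem E, `p`-form**: `a₃` has the edges `f₁ = a₃a₁`, `f₂ = a₃w` and every other edge at `a₃` has
weight `0`. -/
theorem zc_a3w_graph' {p : E → R} (hp : IsProbVec p) {ends : E → Sym2 V} {a₁ a₃ o w : V}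
    {f₁ f₂ : E} (hf : f₁ ≠ f₂) (hends₁ : ends f₁ = s(a₃, a₁)) (hends₂ : ends f₂ = s(a₃, w))
    (hmark : ∀ e, a₃ ∈ ends e → e = f₁ ∨ e = f₂ ∨ p e = 0) (h31 : a₃ ≠ a₁) (h3o : a₃ ≠ o)
    {𝓔 : Set (Set V)} (h𝓔 : IsUpperSet 𝓔)
    (hZ : let p' := Function.update (Function.update p f₁ 0) f₂ 0
      let 𝓔' : Set (Set V) := {S | insert a₃ S ∈ 𝓔}
      let e' := connEvent ends a₁ w
      let L' := connEvent ends a₁ o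
      let U' := clusterInEvent ends a₁ 𝓔'
      let γ' := connEvent ends w o
      0 ≤ prob p' (e'ᶜ ∩ L'ᶜ ∩ γ'ᶜ) * (prob p' (U' ∩ (e' ∩ L')) - prob p' U' * prob p' (e' ∩ L'))
        - prob p' (e'ᶜ ∩ L'ᶜ ∩ γ') * (prob p' (U' ∩ (e' ∩ L'ᶜ)) - prob p' U' * prob p' (e' ∩ L'ᶜ))) :
    let e := connEvent ends a₁ a₃
    let L := connEvent ends a₁ o
    let U := clusterInEvent ends a₁ 𝓔
    let γ := connEvent ends a₃ o
    0 ≤ prob p (eᶜ ∩ Lᶜ ∩ γᶜ) * (prob p (U ∩ (e ∩ L)) - prob p U * prob p (e ∩ L))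
      - prob p (eᶜ ∩ Lᶜ ∩ γ) * (prob p (U ∩ (e ∩ Lᶜ)) - prob p U * prob p (e ∩ Lᶜ)) := by
  intro e L U γ
  simp only at hZ
  classical
  set Z : Finset E := Finset.univ.filter (fun e => e ≠ f₁ ∧ e ≠ f₂ ∧ a₃ ∈ ends e) with hZdef
  have hZ0 : ∀ e ∈ Z, p e = 0 := by
    intro e he
    simp only [hZdef, Finset.mem_filter, Finset.mem_univ, true_and] at he
    rcases hmark e he.2.2 with h | h | h
    · exact absurd h he.1
    · exact absurd h he.2.1
    · exact h
  have hf1Z : f₁ ∉ Z := by simp [hZdef]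
  have hf2Z : f₂ ∉ Z := by simp [hZdef]
  have hagree := reroute_agree ends Z a₁
  have hends₁' : (fun e => if e ∈ Z then s(a₁, a₁) else ends e) f₁ = s(a₃, a₁) := by
    simp only [hf1Z, if_false]; exact hends₁
  have hends₂' : (fun e => if e ∈ Z then s(a₁, a₁) else ends e) f₂ = s(a₃, w) := by
    simp only [hf2Z, if_false]; exact hends₂
  have hmark' : ∀ e, a₃ ∈ (fun e => if e ∈ Z then s(a₁, a₁) else ends e) e → e = f₁ ∨ e = f₂ := by
    intro e he
    by_cases heZ : e ∈ Z
    · simp only [heZ, if_true, Sym2.mem_iff, or_self] at he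
      exact absurd he h31
    · simp only [heZ, if_false] at he
      simp only [hZdef, Finset.mem_filter, Finset.mem_univ, true_and, not_and] at heZ
      by_cases h1 : e = f₁
      · exact Or.inl h1
      · exact Or.inr (by_contra fun h2 => absurd (heZ h1 h2) (fun h => h he))
  have hZ0' : ∀ e ∈ Z, Function.update (Function.update p f₁ 0) f₂ 0 e = 0 :=
    fun e he => update_two_zero_of_zero p f₁ f₂ e (hZ0 e he)
  have hc₁ := zc_expr_congr (Function.update (Function.update p f₁ 0) f₂ 0) Z hZ0' hagree a₁ w o
    {S | insert a₃ S ∈ 𝓔}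
  simp only at hc₁
  have key := zc_a3w_graph hp hf hends₁' hends₂' hmark' h31 h3o h𝓔 (hZ.trans_eq hc₁)
  simp only at key
  have hc := zc_expr_congr p Z hZ0 hagree a₁ a₃ o 𝓔
  simp only at hc
  exact key.trans_eq hc.symm

/-- **Theorem G, `p`-form**: `o` has the edges `f₁ = oa₁`, `f₂ = ow` and every other edge at `o` has
weight `0`. -/
theorem zc_ow_graph' {p : E → R} (hp : IsProbVec p) {ends : E → Sym2 V} {a₁ a₃ o w : V}
    {f₁ f₂ : E} (hf : f₁ ≠ f₂) (hends₁ : ends f₁ = s(o, a₁)) (hends₂ : ends f₂ = s(o, w))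
    (hmark : ∀ e, o ∈ ends e → e = f₁ ∨ e = f₂ ∨ p e = 0) (ho1 : o ≠ a₁) (ho3 : o ≠ a₃)
    {𝓔 : Set (Set V)} (h𝓔 : IsUpperSet 𝓔)
    (hZ : let p' := Function.update (Function.update p f₁ 0) f₂ 0
      let 𝓔' : Set (Set V) := {S | insert o S ∈ 𝓔}
      let e' := connEvent ends a₁ a₃
      let L' := connEvent ends a₁ w
      let U' := clusterInEvent ends a₁ 𝓔'
      let γ' := connEvent ends a₃ w
      0 ≤ prob p' (e'ᶜ ∩ L'ᶜ ∩ γ'ᶜ) * (prob p' (U' ∩ (e' ∩ L')) - prob p' U' * prob p' (e' ∩ L'))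
        - prob p' (e'ᶜ ∩ L'ᶜ ∩ γ') * (prob p' (U' ∩ (e' ∩ L'ᶜ)) - prob p' U' * prob p' (e' ∩ L'ᶜ))) :
    let e := connEvent ends a₁ a₃
    let L := connEvent ends a₁ o
    let U := clusterInEvent ends a₁ 𝓔
    let γ := connEvent ends a₃ o
    0 ≤ prob p (eᶜ ∩ Lᶜ ∩ γᶜ) * (prob p (U ∩ (e ∩ L)) - prob p U * prob p (e ∩ L))
      - prob p (eᶜ ∩ Lᶜ ∩ γ) * (prob p (U ∩ (e ∩ Lᶜ)) - prob p U * prob p (e ∩ Lᶜ)) := by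
  intro e L U γ
  simp only at hZ
  classical
  set Z : Finset E := Finset.univ.filter (fun e => e ≠ f₁ ∧ e ≠ f₂ ∧ o ∈ ends e) with hZdef
  have hZ0 : ∀ e ∈ Z, p e = 0 := by
    intro e he
    simp only [hZdef, Finset.mem_filter, Finset.mem_univ, true_and] at he
    rcases hmark e he.2.2 with h | h | h
    · exact absurd h he.1
    · exact absurd h he.2.1
    · exact h
  have hf1Z : f₁ ∉ Z := by simp [hZdef]
  have hf2Z : f₂ ∉ Z := by simp [hZdef]
  have hagree := reroute_agree ends Z a₁
  have hends₁' : (fun e => if e ∈ Z then s(a₁, a₁) else ends e) f₁ = s(o, a₁) := by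
    simp only [hf1Z, if_false]; exact hends₁
  have hends₂' : (fun e => if e ∈ Z then s(a₁, a₁) else ends e) f₂ = s(o, w) := by
    simp only [hf2Z, if_false]; exact hends₂
  have hmark' : ∀ e, o ∈ (fun e => if e ∈ Z then s(a₁, a₁) else ends e) e → e = f₁ ∨ e = f₂ := by
    intro e he
    by_cases heZ : e ∈ Z
    · simp only [heZ, if_true, Sym2.mem_iff, or_self] at he
      exact absurd he ho1
    · simp only [heZ, if_false] at he
      simp only [hZdef, Finset.mem_filter, Finset.mem_univ, true_and, not_and] at heZ
      by_cases h1 : e = f₁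
      · exact Or.inl h1
      · exact Or.inr (by_contra fun h2 => absurd (heZ h1 h2) (fun h => h he))
  have hZ0' : ∀ e ∈ Z, Function.update (Function.update p f₁ 0) f₂ 0 e = 0 :=
    fun e he => update_two_zero_of_zero p f₁ f₂ e (hZ0 e he)
  have hc₁ := zc_expr_congr (Function.update (Function.update p f₁ 0) f₂ 0) Z hZ0' hagree a₁ a₃ w
    {S | insert o S ∈ 𝓔}
  simp only at hc₁
  have key := zc_ow_graph hp hf hends₁' hends₂' hmark' ho1 ho3 h𝓔 (hZ.trans_eq hc₁)
  simp only at key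
  have hc := zc_expr_congr p Z hZ0 hagree a₁ a₃ o 𝓔
  simp only at hc
  exact key.trans_eq hc.symm

/-- **Theorem F, `p`-form**: the root `a₁` has the edges `f₁ = a₁a₃`, `f₂ = a₁w` and every other edge
at `a₁` has weight `0`. -/
theorem zc_rootw_graph' {p : E → R} (hp : IsProbVec p) {ends : E → Sym2 V} {a₁ a₃ o w : V}
    {f₁ f₂ : E} (hf : f₁ ≠ f₂) (hends₁ : ends f₁ = s(a₁, a₃)) (hends₂ : ends f₂ = s(a₁, w))
    (hroot : ∀ e, a₁ ∈ ends e → e = f₁ ∨ e = f₂ ∨ p e = 0) (h13 : a₁ ≠ a₃) (h1o : a₁ ≠ o)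
    {𝓔 : Set (Set V)} (h𝓔 : IsUpperSet 𝓔) (h𝓔₁ : ({a₁} : Set V) ∉ 𝓔)
    (hZ : let p' := Function.update (Function.update p f₁ 0) f₂ 0
      let 𝓔' : Set (Set V) := {S | insert a₁ S ∈ 𝓔}
      let e' := connEvent ends w a₃
      let L' := connEvent ends w o
      let U' := clusterInEvent ends w 𝓔'
      let γ' := connEvent ends a₃ o
      0 ≤ prob p' (e'ᶜ ∩ L'ᶜ ∩ γ'ᶜ) * (prob p' (U' ∩ (e' ∩ L')) - prob p' U' * prob p' (e' ∩ L'))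
        - prob p' (e'ᶜ ∩ L'ᶜ ∩ γ') * (prob p' (U' ∩ (e' ∩ L'ᶜ)) - prob p' U' * prob p' (e' ∩ L'ᶜ))) :
    let e := connEvent ends a₁ a₃
    let L := connEvent ends a₁ o
    let U := clusterInEvent ends a₁ 𝓔
    let γ := connEvent ends a₃ o
    0 ≤ prob p (eᶜ ∩ Lᶜ ∩ γᶜ) * (prob p (U ∩ (e ∩ L)) - prob p U * prob p (e ∩ L))
      - prob p (eᶜ ∩ Lᶜ ∩ γ) * (prob p (U ∩ (e ∩ Lᶜ)) - prob p U * prob p (e ∩ Lᶜ)) := by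
  intro e L U γ
  simp only at hZ
  classical
  set Z : Finset E := Finset.univ.filter (fun e => e ≠ f₁ ∧ e ≠ f₂ ∧ a₁ ∈ ends e) with hZdef
  have hZ0 : ∀ e ∈ Z, p e = 0 := by
    intro e he
    simp only [hZdef, Finset.mem_filter, Finset.mem_univ, true_and] at he
    rcases hroot e he.2.2 with h | h | h
    · exact absurd h he.1
    · exact absurd h he.2.1
    · exact h
  have hf1Z : f₁ ∉ Z := by simp [hZdef]
  have hf2Z : f₂ ∉ Z := by simp [hZdef]
  have hagree := reroute_agree ends Z a₃
  have hends₁' : (fun e => if e ∈ Z then s(a₃, a₃) else ends e) f₁ = s(a₁, a₃) := by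
    simp only [hf1Z, if_false]; exact hends₁
  have hends₂' : (fun e => if e ∈ Z then s(a₃, a₃) else ends e) f₂ = s(a₁, w) := by
    simp only [hf2Z, if_false]; exact hends₂
  have hroot' : ∀ e, a₁ ∈ (fun e => if e ∈ Z then s(a₃, a₃) else ends e) e → e = f₁ ∨ e = f₂ := by
    intro e he
    by_cases heZ : e ∈ Z
    · simp only [heZ, if_true, Sym2.mem_iff, or_self] at he
      exact absurd he h13
    · simp only [heZ, if_false] at he
      simp only [hZdef, Finset.mem_filter, Finset.mem_univ, true_and, not_and] at heZ
      by_cases h1 : e = f₁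
      · exact Or.inl h1
      · exact Or.inr (by_contra fun h2 => absurd (heZ h1 h2) (fun h => h he))
  have hZ0' : ∀ e ∈ Z, Function.update (Function.update p f₁ 0) f₂ 0 e = 0 :=
    fun e he => update_two_zero_of_zero p f₁ f₂ e (hZ0 e he)
  have hc₁ := zc_expr_congr (Function.update (Function.update p f₁ 0) f₂ 0) Z hZ0' hagree w a₃ o
    {S | insert a₁ S ∈ 𝓔}
  simp only at hc₁
  have key := zc_rootw_graph hp hf hends₁' hends₂' hroot' h13 h1o h𝓔 h𝓔₁ (hZ.trans_eq hc₁)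
  simp only at key
  have hc := zc_expr_congr p Z hZ0 hagree a₁ a₃ o 𝓔
  simp only at hc
  exact key.trans_eq hc.symm

/-- **Theorem H, `p`-form**: the root `a₁` has the edges `f₁ = a₁o`, `f₂ = a₁w` and every other edge
at `a₁` has weight `0`. -/
theorem zc_rootow_graph' {p : E → R} (hp : IsProbVec p) {ends : E → Sym2 V} {a₁ a₃ o w : V}
    {f₁ f₂ : E} (hf : f₁ ≠ f₂) (hends₁ : ends f₁ = s(a₁, o)) (hends₂ : ends f₂ = s(a₁, w))
    (hroot : ∀ e, a₁ ∈ ends e → e = f₁ ∨ e = f₂ ∨ p e = 0) (h13 : a₁ ≠ a₃) (h1o : a₁ ≠ o)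
    {𝓔 : Set (Set V)} (h𝓔 : IsUpperSet 𝓔) (h𝓔₁ : ({a₁} : Set V) ∉ 𝓔)
    (hZ : let p' := Function.update (Function.update p f₁ 0) f₂ 0
      let 𝓔' : Set (Set V) := {S | insert a₁ S ∈ 𝓔}
      let e' := connEvent ends w a₃
      let L' := connEvent ends w o
      let U' := clusterInEvent ends w 𝓔'
      let γ' := connEvent ends a₃ o
      0 ≤ prob p' (e'ᶜ ∩ L'ᶜ ∩ γ'ᶜ) * (prob p' (U' ∩ (e' ∩ L')) - prob p' U' * prob p' (e' ∩ L'))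
        - prob p' (e'ᶜ ∩ L'ᶜ ∩ γ') * (prob p' (U' ∩ (e' ∩ L'ᶜ)) - prob p' U' * prob p' (e' ∩ L'ᶜ))) :
    let e := connEvent ends a₁ a₃
    let L := connEvent ends a₁ o
    let U := clusterInEvent ends a₁ 𝓔
    let γ := connEvent ends a₃ o
    0 ≤ prob p (eᶜ ∩ Lᶜ ∩ γᶜ) * (prob p (U ∩ (e ∩ L)) - prob p U * prob p (e ∩ L))
      - prob p (eᶜ ∩ Lᶜ ∩ γ) * (prob p (U ∩ (e ∩ Lᶜ)) - prob p U * prob p (e ∩ Lᶜ)) := by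
  intro e L U γ
  simp only at hZ
  classical
  set Z : Finset E := Finset.univ.filter (fun e => e ≠ f₁ ∧ e ≠ f₂ ∧ a₁ ∈ ends e) with hZdef
  have hZ0 : ∀ e ∈ Z, p e = 0 := by
    intro e he
    simp only [hZdef, Finset.mem_filter, Finset.mem_univ, true_and] at he
    rcases hroot e he.2.2 with h | h | h
    · exact absurd h he.1
    · exact absurd h he.2.1
    · exact h
  have hf1Z : f₁ ∉ Z := by simp [hZdef]
  have hf2Z : f₂ ∉ Z := by simp [hZdef]
  have hagree := reroute_agree ends Z a₃
  have hends₁' : (fun e => if e ∈ Z then s(a₃, a₃) else ends e) f₁ = s(a₁, o) := by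
    simp only [hf1Z, if_false]; exact hends₁
  have hends₂' : (fun e => if e ∈ Z then s(a₃, a₃) else ends e) f₂ = s(a₁, w) := by
    simp only [hf2Z, if_false]; exact hends₂
  have hroot' : ∀ e, a₁ ∈ (fun e => if e ∈ Z then s(a₃, a₃) else ends e) e → e = f₁ ∨ e = f₂ := by
    intro e he
    by_cases heZ : e ∈ Z
    · simp only [heZ, if_true, Sym2.mem_iff, or_self] at he
      exact absurd he h13
    · simp only [heZ, if_false] at he
      simp only [hZdef, Finset.mem_filter, Finset.mem_univ, true_and, not_and] at heZ
      by_cases h1 : e = f₁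
      · exact Or.inl h1
      · exact Or.inr (by_contra fun h2 => absurd (heZ h1 h2) (fun h => h he))
  have hZ0' : ∀ e ∈ Z, Function.update (Function.update p f₁ 0) f₂ 0 e = 0 :=
    fun e he => update_two_zero_of_zero p f₁ f₂ e (hZ0 e he)
  have hc₁ := zc_expr_congr (Function.update (Function.update p f₁ 0) f₂ 0) Z hZ0' hagree w a₃ o
    {S | insert a₁ S ∈ 𝓔}
  simp only at hc₁
  have key := zc_rootow_graph hp hf hends₁' hends₂' hroot' h13 h1o h𝓔 h𝓔₁ (hZ.trans_eq hc₁)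
  simp only at key
  have hc := zc_expr_congr p Z hZ0 hagree a₁ a₃ o 𝓔
  simp only at hc
  exact key.trans_eq hc.symm

end InsertP

end Summit.Ventures.PercRepro2
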